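/-
Copyright: h21 programme. Stub-ideation companion (k = 2, GENERATION 8, HOME FAMILY 2 — RESHAPE) —
NOT a route file, NOT a Theorems file.  Elaboration sanity: the reshaped target, its PROVED glue to the
registered stub, the PROVED three-piece composition, and every OPEN helper with its final signature
(`sorry`).  Imports no other crux workfile (vocabulary copied, not imported).
-/
import Literature.NumberTheory.Automorphic.CDTTheorem712
import Literature.NumberTheory.EllipticCurves.ModFiveCongruenceHesseFamily
import Literature.NumberTheory.EllipticCurves.TorsionFrobenius
import Literature.NumberTheory.EllipticCurves.TorsionFrobeniusChebotarevProofs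
import Literature.NumberTheory.EllipticCurves.TateCurve.NumberFieldUniformizationTwistedTateJ
import Literature.NumberTheory.EllipticCurves.MultiplicativeTransvectionPrimeToVProofs
import Literature.NumberTheory.EllipticCurves.AdditiveReductionRamifiedTorsionLevelProofs
import Literature.NumberTheory.EllipticCurves.GoodReductionUnramifiedProofs
import Literature.NumberTheory.EllipticCurves.DivisionFieldRamificationPrimePowProofs
import Literature.NumberTheory.EllipticCurves.OpenImageMazurCharacterProofs
import Literature.NumberTheory.GaloisRepresentations.DecompositionGroupOfCompletion
import Literature.NumberTheory.DiophantineGeometry.MinimalDiscriminant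
import HarnessLib

/-!
# Stub-ideation k = 2, GENERATION 8 (RESHAPE, two techniques deep) for `stub_switch` of crux `FreyModularity`

Companion to `STUB-IDEAS-stub_switch-2.md` (gen 8; supersedes the gen-7 plan, keeps the gen 2–7 road).

ROAD (unchanged): NONSPLIT-CUSP FORCING + SQUARE TRICK.  From `ρ̄ ≅ W[5]` absolutely irreducible over
`ℚ(√5)` get `τ ∈ Γ_ℚ` with `ρ̄(τ)² = −1`; a Chebotarev prime `q` with `Frob_q ~ τ²` on `W[M]`
(`M = 2640·|c₄³−c₆²|`) has `Frob_q = −1` on `W[5]` and `q ≡ □ (mod M)`; the member `E_l` of Fisher's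
`5`-congruence family `X_W(5) ≅ ℙ¹` taken `q`-adically next to a cusp (`v_q 𝔇_W(l,1) = 1`) has
`E_l[5] ≅ W[5]` (Fisher Thm 13.2, named fact) and multiplicative reduction at `q` with `v_q(Δ_min) = 5`;
the twisted Tate curve at `q` forces `(Frob_q + 1)² = 0` on `E_l[3]`, so a `Γ_ℚ`-stable line of `E_l[3]`
would have character value `−1` at `Frob_q`, while every quadratic character unramified outside `M`
takes the value `(+1) = ψ(τ)²` there — contradiction; irreducible + the inertial transvection at `q`
(`3 ∤ 5`) ⇒ `ρ̄_{E_l,3}` onto `GL₂(𝔽₃)` ⇒ absolutely irreducible over `ℚ(√−3)`.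

GEN-8 RESHAPE (technique 1 — RE-CUT INTO THREE INDEPENDENT PIECES with a PROVED join):
`CuspForcedSource ⇐ SquareSource ∧ IntegralModel ∧ CuspMemberSource ∧ SurjThreeOfCuspData`
(`cuspForcedSource_of_pieces`, PROVED below), so that three provers can work in parallel and every
helper conclusion is consumed SYNTACTICALLY by the piece it belongs to.
GEN-8 RESHAPE (technique 2 — LOCALISATION of the Tate step onto LANDED tree theorems): the only
analytic input, "`Frob_q = −1` on `E[5]` + multiplicative at `q ≡ 1 (15)` ⇒ `(Frob_q+1)² = 0` on `E[3]`",
is cut into a PURE LOCAL lemma about an abstract twisted Tate parametrisation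
(`helper_twistedTate_addOneSq_local`, shape of `TateParametrisationTwistedTorsion.lean`, fed by the
PROVED `TateCurve.exists_twistedTateUniformisation_tateJ`) and a transport lemma
(`helper_frob_addOneSq_three`, pattern of the PROVED `exists_unipotent_of_hasMultiplicativeReductionAt`);
no "non-split" notion, no Weil pairing, no identification of the stable line with the Tate line.
Likewise the semistability transfer `E_l` ← `W` is now the PROVED
`exists_mem_inertia_smul_geomTorsion_ne_of_hasAdditiveReductionAt` + `smul_geomTorsion_eq_of_mem_inertia`,
and the
unramifiedness of a line character at a multiplicative prime is the PROVED
`exists_tateBasis_geomTorsion_of_hasMultiplicativeReductionAt`.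

Disproof honoured: `Disproof.switch_false_without_det` — `det ρ̄ = χ̄₅` onto is used in G1′ (and is
NECESSARY for G1a′: `H = S₃ ⊂ N(C_ns)` alone has no `g` with `g² = −1`).
-/

set_option linter.dupNamespace false
set_option linter.unusedVariables false

noncomputable section

open scoped NumberField Classical
open Literature.NumberTheory.EllipticCurves Literature.NumberTheory.EllipticCurves.HesseFamilyFive
open Literature.NumberTheory.Automorphic Literature.NumberTheory.GaloisRepresentations
open Literature.NumberTheory.Automorphic.BCDT WeierstrassCurve Field NumberField IsDedekindDomain Matrix

namespace Summit.ABC.ABC.Cruxes.FreyModularity.StubSwitchK2G8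

/-! ## §0 Vocabulary (copied from the gen-2/5 companions; `Iff.rfl`-equal) -/

/-- `Sig.stub_switch` verbatim (the registered stub's statement; = `BCDT.CDT_three_five_switch`). -/
def StubSwitch : Prop :=
  ∀ (W : WeierstrassCurve ℚ) [W.IsElliptic], ¬ 27 ∣ W.conductorNorm ℤ →
    (∀ ρ₃ : ModPGaloisRep ℚ (ZMod 3) 2, W.IsTorsionGaloisRep 3 ρ₃ →
      ¬ ρ₃.IsAbsIrreducibleOverSqrt (-3)) →
    ∀ (ρ : ModPGaloisRep ℚ (ZMod 5) 2), W.IsTorsionGaloisRep 5 ρ → ρ.IsAbsIrreducibleOverSqrt 5 →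
    ∃ (W' : WeierstrassCurve ℚ) (_ : W'.IsElliptic), W'.IsTorsionGaloisRep 5 ρ ∧
      ∃ ρ₃' : ModPGaloisRep ℚ (ZMod 3) 2, W'.IsTorsionGaloisRep 3 ρ₃' ∧
        ρ₃'.IsAbsIrreducibleOverSqrt (-3)

theorem stubSwitch_iff_CDT_three_five_switch : StubSwitch ↔ CDT_three_five_switch := Iff.rfl

/-- Member `E_{l,m}` of Fisher's direct `5`-congruence family of `y² = x³ − 27c₄x − 54c₆`. -/
abbrev member (c₄ c₆ l m : ℚ) : WeierstrassCurve ℚ :=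
  ⟨0, 0, 0, -27 * C4 c₄ c₆ l m, -54 * C6 c₄ c₆ l m⟩

/-- The `c₄c₆`-model (= the member at `(l:m) = (1:0)`). -/
abbrev base (c₄ c₆ : ℚ) : WeierstrassCurve ℚ := ⟨0, 0, 0, -27 * c₄, -54 * c₆⟩

/-- The modulus of the line: `M = 2640·|c₄³ − c₆²|` (`2640 = 2⁴·3·5·11`; `8`, `3`, `5`, `11` and every
prime of bad reduction of the INTEGRAL model `base c₄ c₆` divide it; `11` because of the denominators
`17424 = 2⁴3²11²`, `240` of Fisher's `𝔠₄, 𝔠₆`). -/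
def modulus (c₄ c₆ : ℤ) : ℕ := 2640 * (c₄ ^ 3 - c₆ ^ 2).natAbs

/-- **The reshaped 3-side target (gen 2, verbatim).** -/
def CuspForcedSource : Prop :=
  ∀ (W : WeierstrassCurve ℚ) [W.IsElliptic] (ρ : ModPGaloisRep ℚ (ZMod 5) 2),
    W.IsTorsionGaloisRep 5 ρ → ρ.IsAbsIrreducibleOverSqrt 5 →
    ∃ (W' : WeierstrassCurve ℚ) (_ : W'.IsElliptic), Congr W' W ∧
      W'.HasSurjectiveModNGaloisRep ((3 : ℕ) : ℤ)

/-! ## §1 TOP GLUE (PROVED, gen 2): `CuspForcedSource ⇒ stub_switch` -/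

theorem isTorsionGaloisRep_of_congr {W W' : WeierstrassCurve ℚ} (h : Congr W' W)
    {ρ : ModPGaloisRep ℚ (ZMod 5) 2} (hρ : W.IsTorsionGaloisRep 5 ρ) :
    W'.IsTorsionGaloisRep 5 ρ := by
  obtain ⟨e', he'⟩ := h
  obtain ⟨e, he⟩ := hρ
  refine ⟨e'.trans e, fun σ P => ?_⟩
  rw [AddEquiv.trans_apply, AddEquiv.trans_apply, he', he]

theorem surjective_of_hasSurjectiveModNGaloisRep {F : Type} [Field F] {W : WeierstrassCurve F}
    {p : ℕ} [Fact p.Prime] (hs : W.HasSurjectiveModNGaloisRep (p : ℤ)) {ρ : ModPGaloisRep F (ZMod p) 2}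
    (hρ : W.IsTorsionGaloisRep p ρ) : Function.Surjective ρ := by
  obtain ⟨e, he⟩ := hρ
  intro M
  let f : (Fin 2 → ZMod p) ≃+ (Fin 2 → ZMod p) :=
    { toFun := fun v ↦ (M : Matrix (Fin 2) (Fin 2) (ZMod p)) *ᵥ v
      invFun := fun v ↦ ((M⁻¹ : GL (Fin 2) (ZMod p)) : Matrix (Fin 2) (Fin 2) (ZMod p)) *ᵥ v
      left_inv := fun v ↦ by
        simp only [Matrix.mulVec_mulVec, Units.inv_mul, Matrix.one_mulVec]
      right_inv := fun v ↦ by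
        simp only [Matrix.mulVec_mulVec, Units.mul_inv, Matrix.one_mulVec]
      map_add' := fun v w ↦ Matrix.mulVec_add _ _ _ }
  have hf : ∀ v, f v = (M : Matrix (Fin 2) (Fin 2) (ZMod p)) *ᵥ v := fun _ ↦ rfl
  obtain ⟨σ, hσ⟩ := hs (Multiplicative.ofAdd (e.trans (f.trans e.symm)))
  have hσP : ∀ P : geomTorsion W p, σ • P = e.symm (f (e P)) := fun P ↦ by
    have h := W.galoisRepTorsion_apply (p : ℤ) σ P
    rw [hσ, toAdd_ofAdd] at h
    exact h.symm
  refine ⟨σ, ?_⟩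
  have hv : ∀ v : Fin 2 → ZMod p,
      ((ρ σ : GL (Fin 2) (ZMod p)) : Matrix (Fin 2) (Fin 2) (ZMod p)) *ᵥ v =
        (M : Matrix (Fin 2) (Fin 2) (ZMod p)) *ᵥ v := fun v ↦ by
    have h := he σ (e.symm v)
    rw [hσP, AddEquiv.apply_symm_apply, AddEquiv.apply_symm_apply, hf] at h
    exact h.symm
  have hmat : ((ρ σ : GL (Fin 2) (ZMod p)) : Matrix (Fin 2) (Fin 2) (ZMod p)) =
      (M : Matrix (Fin 2) (Fin 2) (ZMod p)) :=
    Matrix.toLin'.injective (LinearMap.ext fun v ↦ by rw [Matrix.toLin'_apply, Matrix.toLin'_apply, hv])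
  exact Units.ext hmat

/-- **`CuspForcedSource ⇒ stub_switch` (PROVED).** -/
theorem stubSwitch_of_cuspForcedSource (h : CuspForcedSource) : StubSwitch := by
  intro W _ _ _ ρ hρ hirr
  obtain ⟨W', hW', hc, hs⟩ := h W ρ hρ hirr
  haveI := hW'
  haveI : Fact (Nat.Prime 3) := ⟨Nat.prime_three⟩
  haveI : NeZero ((3 : ℕ) : ℚ) := ⟨by norm_num⟩
  obtain ⟨ρ₃, hρ₃⟩ := W'.exists_isTorsionGaloisRep 3
  exact ⟨W', hW', isTorsionGaloisRep_of_congr hc hρ, ρ₃, hρ₃,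
    isAbsIrreducibleOverSqrt_neg_three_of_surjective ρ₃
      (surjective_of_hasSurjectiveModNGaloisRep hs hρ₃)⟩

theorem CDT_three_five_switch_of_cuspForcedSource (h : CuspForcedSource) : CDT_three_five_switch :=
  stubSwitch_iff_CDT_three_five_switch.mp (stubSwitch_of_cuspForcedSource h)

/-! ## §2 THE THREE PIECES (gen-8 cut) and their PROVED join -/

/-- **Piece A `SquareSource` (S, pure group theory + framing): a Galois element whose SQUARE is `−1` on
`W[5]`, with `χ̄₅(τ²) = 1`.**  (= G1a′ `NegOneIsSquare` + G1′.) -/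
def SquareSource : Prop :=
  ∀ (W : WeierstrassCurve ℚ) [W.IsElliptic] (ρ : ModPGaloisRep ℚ (ZMod 5) 2),
    W.IsTorsionGaloisRep 5 ρ → ρ.IsAbsIrreducibleOverSqrt 5 →
    ∃ τ : absoluteGaloisGroup ℚ, (∀ P : W.geomTorsion 5, τ • (τ • P) = -P) ∧
      modNCyclotomicCharacter ℚ 5 (τ * τ) = 1

/-- **Piece I `IntegralModel` (S−, plumbing): every `W/ℚ` is `5`-congruent (indeed `ℚ`-isomorphic) to an
INTEGRAL `c₄c₆`-model.** (`congr_fisherModel`, `scale_smul_short` with `v = d⁶`, `congr_of_smul_eq`.) -/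
def IntegralModel : Prop :=
  ∀ (W : WeierstrassCurve ℚ) [W.IsElliptic], ∃ c₄ c₆ : ℤ, c₄ ^ 3 ≠ c₆ ^ 2 ∧
    ∃ _ : (base (c₄ : ℚ) (c₆ : ℚ)).IsElliptic, Congr (base (c₄ : ℚ) (c₆ : ℚ)) W

/-- **Piece B `CuspMemberSource` (the constructive heart: Chebotarev + cusp forcing + local structure).**
For the integral model `B = base c₄ c₆`, a modulus `M` (multiple of `modulus c₄ c₆`) and `τ` with
`τ² = −1` on `B[5]`, `χ̄₅(τ²) = 1`: there are an integer `l`, a prime `q ∤ M` with its place `v`, a prime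
`𝔓 ∣ q` of `\bar ℤ` and an arithmetic Frobenius `φ` at `𝔓` such that the member `E = E_{l,1}` is
elliptic, `5`-congruent to `B`, semistable away from `M`, multiplicative at `q` with `v_q(Δ_min) = 5`,
and `φ = −1` on `E[5]`, `χ̄₃(φ) = χ̄₅(φ) = 1`, `χ̄_M(φ) = χ̄_M(τ²)`. -/
def CuspMemberSource : Prop :=
  ∀ (c₄ c₆ : ℤ), c₄ ^ 3 ≠ c₆ ^ 2 → ∀ [(base (c₄ : ℚ) (c₆ : ℚ)).IsElliptic] (M : ℕ) [NeZero M]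
    (τ : absoluteGaloisGroup ℚ), modulus c₄ c₆ ∣ M →
    (∀ P : (base (c₄ : ℚ) (c₆ : ℚ)).geomTorsion 5, τ • (τ • P) = -P) →
    modNCyclotomicCharacter ℚ 5 (τ * τ) = 1 →
    ∃ (l : ℤ) (_ : (member (c₄ : ℚ) (c₆ : ℚ) (l : ℚ) 1).IsElliptic) (q : ℕ)
      (v : HeightOneSpectrum (𝓞 ℚ)) (𝔓 : Ideal (absIntegers (𝓞 ℚ) ℚ)) (φ : absoluteGaloisGroup ℚ),
      q.Prime ∧ ¬ q ∣ M ∧ (q : 𝓞 ℚ) ∈ v.asIdeal ∧ 𝔓 ∈ v.primesAbove ∧ IsArithFrobAt (𝓞 ℚ) φ 𝔓 ∧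
      Congr (member (c₄ : ℚ) (c₆ : ℚ) (l : ℚ) 1) (base (c₄ : ℚ) (c₆ : ℚ)) ∧
      (∀ w : HeightOneSpectrum (𝓞 ℚ), (M : 𝓞 ℚ) ∉ w.asIdeal →
        (member (c₄ : ℚ) (c₆ : ℚ) (l : ℚ) 1).IsSemistableAt w) ∧
      (member (c₄ : ℚ) (c₆ : ℚ) (l : ℚ) 1).HasMultiplicativeReductionAt v ∧
      (member (c₄ : ℚ) (c₆ : ℚ) (l : ℚ) 1).ordMinimalDiscriminant v = 5 ∧
      (∀ P : (member (c₄ : ℚ) (c₆ : ℚ) (l : ℚ) 1).geomTorsion 5, φ • P = -P) ∧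
      modNCyclotomicCharacter ℚ 3 φ = 1 ∧ modNCyclotomicCharacter ℚ 5 φ = 1 ∧
      modNCyclotomicCharacter ℚ M φ = modNCyclotomicCharacter ℚ M (τ * τ)

/-- **Piece C `SurjThreeOfCuspData` (Tate + reducible-case contradiction + Serre): the data of Piece B
force `ρ̄_{E,3}` onto `GL₂(𝔽₃)`.** -/
def SurjThreeOfCuspData : Prop :=
  ∀ (E : WeierstrassCurve ℚ) [E.IsElliptic] (M : ℕ) [NeZero M] (q : ℕ) (v : HeightOneSpectrum (𝓞 ℚ))
    (𝔓 : Ideal (absIntegers (𝓞 ℚ) ℚ)) (φ τ : absoluteGaloisGroup ℚ),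
    8 ∣ M → 3 ∣ M →
    (∀ w : HeightOneSpectrum (𝓞 ℚ), (M : 𝓞 ℚ) ∉ w.asIdeal → E.IsSemistableAt w) →
    q.Prime → ¬ q ∣ M → (q : 𝓞 ℚ) ∈ v.asIdeal → 𝔓 ∈ v.primesAbove → IsArithFrobAt (𝓞 ℚ) φ 𝔓 →
    E.HasMultiplicativeReductionAt v → E.ordMinimalDiscriminant v = 5 →
    (∀ P : E.geomTorsion 5, φ • P = -P) →
    modNCyclotomicCharacter ℚ 3 φ = 1 → modNCyclotomicCharacter ℚ 5 φ = 1 →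
    modNCyclotomicCharacter ℚ M φ = modNCyclotomicCharacter ℚ M (τ * τ) →
    E.HasSurjectiveModNGaloisRep ((3 : ℕ) : ℤ)

/-- **THE JOIN (PROVED): `SquareSource ∧ IntegralModel ∧ CuspMemberSource ∧ SurjThreeOfCuspData ⇒
CuspForcedSource`.** -/
theorem cuspForcedSource_of_pieces (hA : SquareSource) (hI : IntegralModel) (hB : CuspMemberSource)
    (hC : SurjThreeOfCuspData) : CuspForcedSource := by
  intro W _ ρ hρ hirr
  obtain ⟨τ, hτ, hχτ⟩ := hA W ρ hρ hirr
  obtain ⟨c₄, c₆, hΔ, hBell, hBW⟩ := hI W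
  haveI := hBell
  haveI : NeZero (modulus c₄ c₆) :=
    ⟨mul_ne_zero (by norm_num) (Int.natAbs_ne_zero.mpr (sub_ne_zero.mpr hΔ))⟩
  have hτB : ∀ P : (base (c₄ : ℚ) (c₆ : ℚ)).geomTorsion 5, τ • (τ • P) = -P := by
    obtain ⟨e, he⟩ := hBW
    intro P
    apply e.injective
    rw [he, he, hτ, map_neg]
  obtain ⟨l, hEll, q, v, 𝔓, φ, hq, hqM, hv, h𝔓, hφ, hcongr, hss, hmult, hord, hneg, h3, h5, hM⟩ :=
    hB c₄ c₆ hΔ (modulus c₄ c₆) τ dvd_rfl hτB hχτ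
  haveI := hEll
  refine ⟨member (c₄ : ℚ) (c₆ : ℚ) (l : ℚ) 1, hEll, congr_trans hcongr hBW, ?_⟩
  exact hC _ (modulus c₄ c₆) q v 𝔓 φ τ (dvd_mul_of_dvd_left (by norm_num) _)
    (dvd_mul_of_dvd_left (by norm_num) _) hss hq hqM hv h𝔓 hφ hmult hord hneg h3 h5 hM

/-- hence the registered stub from the four pieces (PROVED). -/
theorem stubSwitch_of_pieces (hA : SquareSource) (hI : IntegralModel) (hB : CuspMemberSource)
    (hC : SurjThreeOfCuspData) : StubSwitch :=
  stubSwitch_of_cuspForcedSource (cuspForcedSource_of_pieces hA hI hB hC)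

/-! ## §A helpers for `SquareSource` -/

/-- **G1a′ (S; statement VERBATIM = gen-5/gen-7 `NegOneIsSquare`; every finite fact it needs is DECIDED in
`STUB_IDEAS_stub_switch_2g7_Sketch.lean` §2–§3: `orders_SL2`, `invol`, `s3_pair/s3_comm/normC3_gen`,
`u5_pair/u5_comm/normU_gen`, `GL_orders`).**  `G ≤ GL₂(𝔽₅)` with `det G = 𝔽₅ˣ`, `H ≤ G` with
`det(H)² = 1`, `H` without a common eigenline and non-abelian ⇒ some `g ∈ G` has `g² = −1`. -/
def NegOneIsSquare : Prop :=
  ∀ (G H : Subgroup (GL (Fin 2) (ZMod 5))), H ≤ G →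
    (∀ d : (ZMod 5)ˣ, ∃ g ∈ G, Matrix.GeneralLinearGroup.det g = d) →
    (∀ h ∈ H, Matrix.GeneralLinearGroup.det h ^ 2 = 1) →
    (∀ w : Fin 2 → ZMod 5, w ≠ 0 → ∃ h ∈ H, ∀ c : ZMod 5,
      (h : Matrix (Fin 2) (Fin 2) (ZMod 5)) *ᵥ w ≠ c • w) →
    (∃ h₁ ∈ H, ∃ h₂ ∈ H, h₁ * h₂ ≠ h₂ * h₁) →
    ∃ g ∈ G, g * g = -1

/-- G1a′ (S): the sylow-free case analysis of gen 7 §4 over the decided tables. -/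
theorem negOneIsSquare : NegOneIsSquare := by
  sorry

/-- **G1′ (S, framing glue): `G = range ρ̄`, `H = ρ̄(Γ_{ℚ(√5)})`; `det ρ̄ = χ̄₅` onto
(`det_eq_modPCyclotomicCharacter_of_isTorsionGaloisRep_holds`, `χ̄₅` onto over `ℚ`), `χ̄₅² = 1` on
`Γ_{ℚ(√5)}`, no common eigenline / non-abelian from `IsAbsIrreducibleOverSqrt 5`; G1a′ gives `ρ̄(τ)² = −1`,
the frame turns it into `τ • (τ • P) = −P`, and `χ̄₅(τ²) = det(−1) = 1`.** -/
theorem helper_exists_tau_sq_eq_neg (hG : NegOneIsSquare) (W : WeierstrassCurve ℚ) [W.IsElliptic]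
    (ρ : ModPGaloisRep ℚ (ZMod 5) 2) (hρ : W.IsTorsionGaloisRep 5 ρ)
    (hirr : ρ.IsAbsIrreducibleOverSqrt 5) :
    ∃ τ : absoluteGaloisGroup ℚ, (∀ P : W.geomTorsion 5, τ • (τ • P) = -P) ∧
      modNCyclotomicCharacter ℚ 5 (τ * τ) = 1 := by
  sorry

/-- Piece A from G1a′ + G1′ (PROVED glue). -/
theorem squareSource_of (hG : NegOneIsSquare) : SquareSource :=
  fun W _ ρ hρ hirr => helper_exists_tau_sq_eq_neg hG W ρ hρ hirr

/-! ## §I the integral model (S−) -/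

/-- **I0 (S−).** `W ≅ base(W.c₄, W.c₆)` (`congr_fisherModel`), then rescale by `d⁶`, `d` a common
denominator (`scale_smul_short`, `congr_of_smul_eq`, `congr_symm/trans`); `IsElliptic` transports along
variable changes. -/
theorem integralModel : IntegralModel := by
  sorry

/-! ## §B helpers for `CuspMemberSource`
B1 is the TREE fact `chebotarev_geomTorsion_holds` (applied to `base`, level `n = M`, `σ = τ * τ`,
`S = {p : p ∣ M}`); F1 is the tree NAMED FACT `thm132_geomTorsionFive_of_hesseFamily`. -/

/-- **B2 (XS): equal actions on `W[n]` restrict to `W[d]`, `d ∣ n`.** -/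
theorem helper_smul_eq_of_dvd (W : WeierstrassCurve ℚ) {d n : ℤ} (hdn : d ∣ n)
    {φ σ : absoluteGaloisGroup ℚ} (h : ∀ P : W.geomTorsion n, φ • P = σ • P)
    (P : W.geomTorsion d) : φ • P = σ • P := by
  sorry

/-- **B3 = G2 (S): equal actions on `W[n]` ⇒ equal `χ̄_n`** (`det ρ̄_{W,n} = χ̄_n`: tree PROVED
`det_eq_modNCyclotomicCharacter`, one frame of `W[n]` for both elements). -/
theorem helper_cyclotomic_eq_of_smul_eq (W : WeierstrassCurve ℚ) [W.IsElliptic] {n : ℕ} [NeZero n]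
    (hn : 2 ≤ n) {φ σ : absoluteGaloisGroup ℚ} (h : ∀ P : W.geomTorsion n, φ • P = σ • P) :
    modNCyclotomicCharacter ℚ n φ = modNCyclotomicCharacter ℚ n σ := by
  sorry

/-- `(ℤ/3)ˣ` has exponent `2` (PROVED, `decide`). -/
theorem units_zmod3_mul_self (x : (ZMod 3)ˣ) : x * x = 1 := by
  revert x; decide

/-- **B4 (PROVED, XS): `χ̄₃(τ²) = 1`.** -/
theorem helper_chi3_sq (τ : absoluteGaloisGroup ℚ) : modNCyclotomicCharacter ℚ 3 (τ * τ) = 1 := by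
  rw [map_mul]; exact units_zmod3_mul_self _

/-- **B5 = C1-i (S): a Frobenius-fixed algebraic integer is congruent to a rational integer mod `𝔓`.** -/
theorem helper_exists_int_congr_of_frob_fixed {v : HeightOneSpectrum (𝓞 ℚ)}
    {𝔓 : Ideal (absIntegers (𝓞 ℚ) ℚ)} (h𝔓 : 𝔓 ∈ v.primesAbove)
    {φ : absoluteGaloisGroup ℚ} (hφ : IsArithFrobAt (𝓞 ℚ) φ 𝔓)
    (A : absIntegers (𝓞 ℚ) ℚ) (hA : φ • A = A) : ∃ a : ℤ, A - a ∈ 𝔓 := by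
  sorry

/-- **B6 = C1a (M−, the one genuinely new computation of the line): `Frob = −1` on `B[5]` and `χ̄₅(Frob) = 1`
⇒ Fisher's `𝔇_B(·,1)` has a root mod `q`.**  Plan (all inputs kernel-side): `T ∈ B[5]∖0`, `x = x(T)`,
`x(2T) = N(x)/(4f(x))`; `x` is a root of the explicit `ψ₅` (`PSI5` of `…_2g6_Cert.lean`; `= preΨ'₅`,
`zsmul_some_eq_zero_iff_eval_ΨSq`); `p := ζ + ζ⁴` (`ζ` a primitive 5th root) has `p² + p − 1 = 0`;
`φ` fixes `x` (`φT = −T`) and `ζ` (`χ̄₅(φ) = 1`); the KERNEL-CERTIFIED cusp identity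
`D_LL_MM_eq_zero` gives `𝔇(LL(x,p), MM(x)) = 0` with `LL, MM` `φ`-fixed and `𝔓`-integral (`5x ∈ \bar ℤ`,
`q ≠ 5`); if `MM = 12f(x) ∈ 𝔓` then `𝔇 ≡ LL¹² (mod 𝔓)` forces `LL ∈ 𝔓`, hence `N(x) ∈ 𝔓`, and a Bézout
identity `U·f + V·N = 2^a3^b(c₄³−c₆²)^k` (`ring`) contradicts `q ∤ 6(c₄³−c₆²)`; so `ξ = LL/MM` is a
`φ`-fixed `𝔓`-integral root of `𝔇(·,1)`, congruent to some `r ∈ ℤ` (B5), and `q ∣ 𝔇(r,1)` (`𝔓 ∩ ℤ = (q)`). -/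
theorem helper_D_root_mod_q (c₄ c₆ : ℤ) (hΔ : c₄ ^ 3 ≠ c₆ ^ 2) [(base (c₄ : ℚ) (c₆ : ℚ)).IsElliptic]
    {q : ℕ} (hq : q.Prime) (hq0 : ¬ (q : ℤ) ∣ 30 * (c₄ ^ 3 - c₆ ^ 2))
    {v : HeightOneSpectrum (𝓞 ℚ)} (hv : (q : 𝓞 ℚ) ∈ v.asIdeal)
    {𝔓 : Ideal (absIntegers (𝓞 ℚ) ℚ)} (h𝔓 : 𝔓 ∈ v.primesAbove)
    {φ : absoluteGaloisGroup ℚ} (hφ : IsArithFrobAt (𝓞 ℚ) φ 𝔓)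
    (hζ : modNCyclotomicCharacter ℚ 5 φ = 1)
    (hneg : ∀ P : (base (c₄ : ℚ) (c₆ : ℚ)).geomTorsion 5, φ • P = -P) :
    ∃ r : ℤ, (q : ℤ) ∣ D c₄ c₆ r 1 := by
  sorry

/-- **B7 = C1s′ + C2 (S): a root mod `q ∤ 30(c₄³−c₆²)` lifts to `l ∈ ℤ` with `v_q(𝔇(l,1)) = 1`.**
The root is SIMPLE by the PROVED Bézout certificate `bezout_D_Dl`
(`BU·𝔇 + BV·𝔇_λ = −2¹⁸3¹⁰5⁴(c₄³−c₆²)⁴`, `…_2g7_Sketch.lean`, `helper_simple_root_mod_q` PROVED there);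
then `𝔇(r+q) ≡ 𝔇(r) + q·𝔇_λ(r) (mod q²)`, so `l ∈ {r, r+q}` works. -/
theorem helper_lift_root {q : ℕ} (hq : q.Prime) (c₄ c₆ r : ℤ)
    (hq0 : ¬ (q : ℤ) ∣ 30 * (c₄ ^ 3 - c₆ ^ 2)) (hr : (q : ℤ) ∣ D c₄ c₆ r 1) :
    ∃ l : ℤ, padicValInt q (D c₄ c₆ l 1) = 1 := by
  sorry

/-- **B8 = L1 (M−; gen-5 signature with `v` named by `q ∈ v`): the cusp-adjacent member is elliptic,
multiplicative at `q` with `v_q(Δ_min) = 5`.**  `Δ(E_{l,1}) = 2⁶3⁹(c₄³−c₆²)𝔇(l,1)⁵` (PROVED gen 5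
`member_Δ_eq`), `𝔠₄, 𝔠₆` are `q`-integral (`q ∤ 2·3·5·11`), `v_q(𝔠₄³ − 𝔠₆²) = 5 ⇒ q ∤ 𝔠₄` (gen-5 VAL),
an integral model with `v(c₄) = 0 < v(Δ)` is minimal and multiplicative
(`isMinimalAt`/`hasMultiplicativeReductionAt_of_valuation_c₄_eq_one` road of `MinimalDiscriminant`). -/
theorem helper_member_multiplicative (c₄ c₆ l : ℤ) (hΔ : c₄ ^ 3 ≠ c₆ ^ 2) {q : ℕ} (hq : q.Prime)
    (hq0 : ¬ (q : ℤ) ∣ 330 * (c₄ ^ 3 - c₆ ^ 2)) (hl : padicValInt q (D c₄ c₆ l 1) = 1)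
    {v : HeightOneSpectrum (𝓞 ℚ)} (hv : (q : 𝓞 ℚ) ∈ v.asIdeal) :
    ∃ (_ : (member (c₄ : ℚ) (c₆ : ℚ) (l : ℚ) 1).IsElliptic),
      (member (c₄ : ℚ) (c₆ : ℚ) (l : ℚ) 1).HasMultiplicativeReductionAt v ∧
      (member (c₄ : ℚ) (c₆ : ℚ) (l : ℚ) 1).ordMinimalDiscriminant v = 5 := by
  sorry

/-- **F1 (PROVED, 2 lines): Fisher's Theorem 13.2 (tree NAMED FACT) as a `Congr`.** -/
theorem congr_member_base (hF : thm132_geomTorsionFive_of_hesseFamily) (c₄ c₆ l : ℚ)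
    [hE : (base c₄ c₆).IsElliptic] [hE' : (member c₄ c₆ l 1).IsElliptic] :
    Congr (member c₄ c₆ l 1) (base c₄ c₆) := by
  obtain ⟨e, he⟩ := hF (base c₄ c₆) (member c₄ c₆ l 1) c₄ c₆ l 1 rfl rfl
  exact ⟨e, he⟩

/-- **B9 = N1′ (S, NOW TREE-BACKED): the member is semistable at every `w ∤ 30(c₄³−c₆²)`.**
`base` is an integral short model with `Δ = 2⁶3⁹(c₄³−c₆²)` a `w`-unit ⇒ good at `w`
(`hasGoodReductionAt_of_valuation_le_one_of_valuation_Δ_eq_one`) ⇒ the inertia group of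
`𝔓₀ = adicCompletionPrime ℚ w` acts trivially on `base[5]` (`smul_geomTorsion_eq_of_mem_inertia`, `w ∤ 5`)
⇒ via the equivariant `e` of `Congr` trivially on `member[5]` ⇒ not additive
(contrapositive of `exists_mem_inertia_smul_geomTorsion_ne_of_hasAdditiveReductionAt`, `m = 5 ≥ 3`,
`w ∤ 5`; bridge `GreenbergSelmer.inertia w = 𝔓₀.inertia Γ_ℚ` = `inertia_adicCompletionPrime_eq_map_absInertia`,
`adicCompletionPrime_mem_primesAbove`) ⇒ semistable (`isSemistableAt_iff_not_hasAdditiveReductionAt`). -/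
theorem helper_isSemistableAt_member (c₄ c₆ l : ℤ) (hΔ : c₄ ^ 3 ≠ c₆ ^ 2)
    [(base (c₄ : ℚ) (c₆ : ℚ)).IsElliptic] [(member (c₄ : ℚ) (c₆ : ℚ) (l : ℚ) 1).IsElliptic]
    (hc : Congr (member (c₄ : ℚ) (c₆ : ℚ) (l : ℚ) 1) (base (c₄ : ℚ) (c₆ : ℚ)))
    {w : HeightOneSpectrum (𝓞 ℚ)} (hw : ((30 * (c₄ ^ 3 - c₆ ^ 2).natAbs : ℕ) : 𝓞 ℚ) ∉ w.asIdeal) :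
    (member (c₄ : ℚ) (c₆ : ℚ) (l : ℚ) 1).IsSemistableAt w := by
  sorry

/-! ## §C helpers for `SurjThreeOfCuspData` -/

/-- **T1 = N1loc (S, NEW CUT, pure local algebra in the style of `TateParametrisationTwistedTorsion.lean`):**
for a TWISTED Tate parametrisation `Ψ : \bar K_v^* → E(\bar K_v)` (onto, kernel `q^ℤ`,
`σ • Ψ(u) = ε(σ) Ψ(σu)`, `ε(σ) = 1 ↔ σ t = t`) and `σ ∈ Γ_{K_v}` fixing the `p₁p₂`-th roots of unity and
acting as `−1` on the `p₁`-torsion (`p₁` an odd prime): `(σ + 1)² = 0` on the `p₂`-torsion.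
Proof: `L = Ψ(ζ_{p₁}) ≠ 0` (a root of unity is not in `q^ℤ`, `|q| < 1`), `σL = ε(σ)L = −L` forces
`ε(σ) = −1` (`p₁` odd); for `p₂P = 0`, `P = Ψ(u)`, `u^{p₂} = qⁿ` gives `σu = ζu` with `ζ^{p₂} = 1`, so
`σP + P = −Ψ(ζ)` and `σΨ(ζ) = −Ψ(ζ)`. -/
theorem helper_twistedTate_addOneSq_local {K : Type} [Field K] [NumberField K] (W : WeierstrassCurve K)
    [W.IsElliptic] (v : HeightOneSpectrum (𝓞 K)) {q : v.adicCompletion K} (hq0 : q ≠ 0)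
    (hq1 : Valued.v q < 1) (t : AlgebraicClosure (v.adicCompletion K))
    (Ψ : Additive (AlgebraicClosure (v.adicCompletion K))ˣ →+ localPoints W (v.adicCompletion K))
    (hsurj : Function.Surjective Ψ)
    (hker : ∀ u : (AlgebraicClosure (v.adicCompletion K))ˣ, Ψ (Additive.ofMul u) = 0 ↔
      ∃ n : ℤ, (u : AlgebraicClosure (v.adicCompletion K)) =
        algebraMap (v.adicCompletion K) (AlgebraicClosure (v.adicCompletion K)) q ^ n)
    (htw : ∀ (σ : absoluteGaloisGroup (v.adicCompletion K))
        (u : (AlgebraicClosure (v.adicCompletion K))ˣ),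
      σ • Ψ (Additive.ofMul u) =
        (if Field.absoluteGaloisGroup.toAlgEquiv (v.adicCompletion K) σ t = t then (1 : ℤ) else -1) •
        Ψ (Additive.ofMul (Units.map
          (Field.absoluteGaloisGroup.toAlgEquiv (v.adicCompletion K) σ :
            AlgebraicClosure (v.adicCompletion K) →* AlgebraicClosure (v.adicCompletion K)) u)))
    {p₁ p₂ : ℕ} (hp₁ : p₁.Prime) (hp₁2 : p₁ ≠ 2) (hp₂ : 0 < p₂)
    (σ : absoluteGaloisGroup (v.adicCompletion K))
    (hζ : ∀ z : AlgebraicClosure (v.adicCompletion K), z ^ (p₁ * p₂) = 1 →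
      Field.absoluteGaloisGroup.toAlgEquiv (v.adicCompletion K) σ z = z)
    (hneg : ∀ P : localPoints W (v.adicCompletion K), (p₁ : ℤ) • P = 0 → σ • P = -P) :
    ∀ P : localPoints W (v.adicCompletion K), (p₂ : ℤ) • P = 0 →
      σ • (σ • P + P) + (σ • P + P) = 0 := by
  sorry

/-- **T2 = N1glob (S/M−, transport): `E/ℚ` multiplicative at `v ∣ q`, `φ` in the decomposition group of
`𝔓 ∣ v` (e.g. an arithmetic Frobenius, `IsArithFrobAt.mem_stabilizer`), `φ = −1` on `E[5]`,
`χ̄₃(φ) = χ̄₅(φ) = 1` ⇒ `(φ+1)² = 0` on `E[3]`.**  Recipe: conjugate `𝔓` to `𝔓₀ = adicCompletionPrime ℚ v`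
(`HeightOneSpectrum.exists_smul_eq_of_mem_primesAbove_holds`; hypotheses and conclusion are conjugation
invariant), write `g⁻¹φg = res σ`, `σ ∈ Γ_{ℚ_v}` (`decompositionSubgroup_adicCompletionPrime_eq_range`),
take `Ψ` from the PROVED `TateCurve.exists_twistedTateUniformisation_tateJ`, move `E[5]`, `E[3]` into
`E(\bar ℚ_v)` by the injective equivariant `pointsMap` (`pointsMap_smul`, `resGal_eq_absGaloisRestrict`,
`exists_pointsMapOfEmb_eq_of_nsmul_eq_zero` for local torsion being in the image), roots of unity of
`\bar ℚ_v` come from `\bar ℚ` (so `χ̄₁₅ = 1` gives `hζ`), and apply T1 with `(p₁,p₂) = (5,3)`. -/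
theorem helper_frob_addOneSq_three (E : WeierstrassCurve ℚ) [E.IsElliptic]
    {v : HeightOneSpectrum (𝓞 ℚ)} (hmult : E.HasMultiplicativeReductionAt v)
    {𝔓 : Ideal (absIntegers (𝓞 ℚ) ℚ)} (h𝔓 : 𝔓 ∈ v.primesAbove)
    {φ : absoluteGaloisGroup ℚ} (hφ : IsArithFrobAt (𝓞 ℚ) φ 𝔓)
    (h3 : modNCyclotomicCharacter ℚ 3 φ = 1) (h5 : modNCyclotomicCharacter ℚ 5 φ = 1)
    (hneg : ∀ P : E.geomTorsion 5, φ • P = -P) :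
    ∀ Q : E.geomTorsion 3, φ • (φ • Q + Q) + (φ • Q + Q) = 0 := by
  sorry

/-- **FIN2 (S−, linear algebra over `𝔽₃`): `(φ+1)² = 0` on `E[3]` ⇒ `φ = −1` on every `φ`-stable line.** -/
theorem helper_neg_on_line_of_add_one_sq (E : WeierstrassCurve ℚ) [E.IsElliptic]
    {φ : absoluteGaloisGroup ℚ} (hφ : ∀ Q : E.geomTorsion 3, φ • (φ • Q + Q) + (φ • Q + Q) = 0)
    {P : E.geomTorsion 3} (hP0 : P ≠ 0) (hst : φ • P ∈ AddSubgroup.zmultiples P) :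
    φ • P = -P := by
  sorry

/-- **R1 (S): reducible ⇒ a `Γ_ℚ`-stable line** (a proper non-zero stable subgroup of `E[3] ≅ 𝔽₃²`). -/
theorem helper_stable_line_of_not_irreducible (E : WeierstrassCurve ℚ) [E.IsElliptic]
    (h : ¬ E.HasIrreducibleModPGaloisRep 3) :
    ∃ P : E.geomTorsion 3, P ≠ 0 ∧
      ∀ σ : absoluteGaloisGroup ℚ, σ • P ∈ AddSubgroup.zmultiples P := by
  sorry

/-- **R3 (S−; = tree `Mazur1978.exists_isogenyCharacter` + `isOpen_ker_galoisRepTorsion_holds`): the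
character of a stable line, with open kernel.** -/
theorem helper_lineChar (E : WeierstrassCurve ℚ) [E.IsElliptic] {P : E.geomTorsion 3} (hP0 : P ≠ 0)
    (hst : ∀ σ : absoluteGaloisGroup ℚ, σ • P ∈ AddSubgroup.zmultiples P) :
    ∃ r : absoluteGaloisGroup ℚ →* (ZMod 3)ˣ,
      IsOpen ((r.ker : Subgroup (absoluteGaloisGroup ℚ)) : Set (absoluteGaloisGroup ℚ)) ∧
      ∀ σ : absoluteGaloisGroup ℚ, σ • P = ((r σ : (ZMod 3)ˣ) : ZMod 3).val • P := by
  sorry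

/-- **Rneg (S−): a line character takes the value `−1` at `φ` when `φ • P = −P`.** -/
theorem helper_character_neg_one (E : WeierstrassCurve ℚ) [E.IsElliptic]
    {P : E.geomTorsion 3} (hP0 : P ≠ 0) {r : absoluteGaloisGroup ℚ →* (ZMod 3)ˣ}
    (hr : ∀ σ : absoluteGaloisGroup ℚ, σ • P = ((r σ : (ZMod 3)ˣ) : ZMod 3).val • P)
    {φ : absoluteGaloisGroup ℚ} (hφ : φ • P = -P) : r φ = -1 := by
  sorry

/-- **R2 (S, NOW TREE-BACKED): a line character is unramified at every semistable `w ∤ 3`.**  Good: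
`smul_geomTorsion_eq_of_mem_inertia`; multiplicative: the PROVED global Tate basis
`exists_tateBasis_geomTorsion_of_hasMultiplicativeReductionAt` (`p = 3`, `n = 1`: inertia fixes `P₁` and
moves `P₂` inside `P₂ + ℤP₁`, so its only possible eigenvalue on a stable line is `1`). -/
theorem helper_lineChar_unramified (E : WeierstrassCurve ℚ) [E.IsElliptic] {P : E.geomTorsion 3}
    (hP0 : P ≠ 0) {r : absoluteGaloisGroup ℚ →* (ZMod 3)ˣ}
    (hr : ∀ σ : absoluteGaloisGroup ℚ, σ • P = ((r σ : (ZMod 3)ˣ) : ZMod 3).val • P)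
    {w : HeightOneSpectrum (𝓞 ℚ)} (h3w : ((3 : ℕ) : 𝓞 ℚ) ∉ w.asIdeal) (hw : E.IsSemistableAt w)
    {𝔓 : Ideal (absIntegers (𝓞 ℚ) ℚ)} (h𝔓 : 𝔓 ∈ w.primesAbove)
    {σ : absoluteGaloisGroup ℚ} (hσ : σ ∈ 𝔓.inertia (absoluteGaloisGroup ℚ)) : r σ = 1 := by
  sorry

/-- **R4e (S−): `a ≡ 1 (mod p)` ⇒ `a^{p^k} ≡ 1 (mod p^{k+1})`.** -/
theorem helper_pow_prime_pow_congr_one {p : ℕ} (hp : p.Prime) (k : ℕ) {a : ℤ}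
    (ha : a ≡ 1 [ZMOD p]) : a ^ p ^ k ≡ 1 [ZMOD (p : ℤ) ^ (k + 1)] := by
  sorry

/-- **R4d (S−): `a ≡ 1 (mod 8)` ⇒ `a` is a square mod `2^e`.** -/
theorem helper_sq_congr_of_one_mod_eight (e : ℕ) {a : ℤ} (ha : a ≡ 1 [ZMOD 8]) :
    ∃ x : ℤ, x ^ 2 ≡ a [ZMOD (2 : ℤ) ^ e] := by
  sorry

/-- **R4c (S/M−, pure `(ℤ/n)ˣ`):** `8 ∣ m ∣ n`, `β : (ℤ/n)ˣ → (ℤ/3)ˣ` trivial on the full `p`-component for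
every prime `p ∣ n`, `p ∤ m` ⇒ `β` is trivial on `ker((ℤ/n)ˣ → (ℤ/m)ˣ)` (CRT + R4d + R4e; no
unramifiedness at the primes of `m` is ever needed). -/
theorem helper_ker_unitsMap_le_ker {n m : ℕ} [NeZero n] (hmn : m ∣ n) (h8 : 8 ∣ m)
    (β : (ZMod n)ˣ →* (ZMod 3)ˣ)
    (hβ : ∀ p : ℕ, p.Prime → p ∣ n → ¬ p ∣ m →
      ∀ a : (ZMod n)ˣ, ZMod.unitsMap (Nat.ordCompl_dvd n p) a = 1 → β a = 1)
    (a : (ZMod n)ˣ) (ha : ZMod.unitsMap hmn a = 1) : β a = 1 := by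
  sorry

/-- **R4b (S): unramified at `p` ⇒ `β` kills the `p`-component** (tree
`exists_mem_inertia_modNCyclotomicCharacter_eq`). -/
theorem helper_beta_eq_one_of_unramified (ψ : absoluteGaloisGroup ℚ →* (ZMod 3)ˣ)
    {n : ℕ} [NeZero n] (β : (ZMod n)ˣ →* (ZMod 3)ˣ)
    (hβ : ∀ σ : absoluteGaloisGroup ℚ, β (modNCyclotomicCharacter ℚ n σ) = ψ σ)
    {p : ℕ} (hp : p.Prime) {w : HeightOneSpectrum (𝓞 ℚ)} (hw : (p : 𝓞 ℚ) ∈ w.asIdeal)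
    (hunr : ∀ 𝔓 ∈ w.primesAbove, ∀ σ ∈ 𝔓.inertia (absoluteGaloisGroup ℚ), ψ σ = 1)
    (a : (ZMod n)ˣ) (ha : ZMod.unitsMap (Nat.ordCompl_dvd n p) a = 1) : β a = 1 := by
  sorry

/-- **R4 (S given R4b/R4c; Kronecker–Weber = tree PROVED `exists_comp_modNCyclotomicCharacter_eq`):** a
character `Γ_ℚ → (ℤ/3)ˣ` with open kernel, unramified at every `w ∤ m` (`8 ∣ m`), takes equal values on
elements with equal `χ̄_m`.  Consumed with `σ = Frob_q`, `σ' = τ²`: `ψ(Frob_q) = ψ(τ)² = 1`. -/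
theorem helper_char_eq_of_cyclotomic_eq {m : ℕ} [NeZero m] (h8 : 8 ∣ m)
    (ψ : absoluteGaloisGroup ℚ →* (ZMod 3)ˣ)
    (hker : IsOpen ((ψ.ker : Subgroup (absoluteGaloisGroup ℚ)) : Set (absoluteGaloisGroup ℚ)))
    (hunr : ∀ (w : HeightOneSpectrum (𝓞 ℚ)), (m : 𝓞 ℚ) ∉ w.asIdeal →
      ∀ 𝔓 ∈ w.primesAbove, ∀ σ ∈ 𝔓.inertia (absoluteGaloisGroup ℚ), ψ σ = 1)
    {σ σ' : absoluteGaloisGroup ℚ}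
    (hσ : modNCyclotomicCharacter ℚ m σ = modNCyclotomicCharacter ℚ m σ') : ψ σ = ψ σ' := by
  sorry

/-- **R5 (S given the tree): irreducible and `3 ∣ #ρ̄_{E,3}(Γ_ℚ)` ⇒ onto `GL₂(𝔽₃)`** (two transvections
with distinct lines generate `SL₂(𝔽₃)` — all conjugates of the transvection share a line only if that line
is stable; `det = χ̄₃` onto). -/
theorem helper_surjective_three_of_irreducible_of_three_dvd (E : WeierstrassCurve ℚ) [E.IsElliptic]
    (hirr : E.HasIrreducibleModPGaloisRep 3)
    (h3 : 3 ∣ Nat.card (galoisRepTorsion E ((3 : ℕ) : ℤ)).range) :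
    E.HasSurjectiveModNGaloisRep ((3 : ℕ) : ℤ) := by
  sorry

/-! ## §G PROVED GLUE: the helpers give Pieces B and C (every helper conclusion consumed by name) -/

/-- coprimality plumbing (PROVED): a place containing the prime `q ≠ 3` does not contain `3`. -/
theorem helper_three_not_mem {q : ℕ} (hq : q.Prime) (hq3 : q ≠ 3) {v : HeightOneSpectrum (𝓞 ℚ)}
    (hv : (q : 𝓞 ℚ) ∈ v.asIdeal) : ((3 : ℕ) : 𝓞 ℚ) ∉ v.asIdeal := by
  intro h3
  have hcop : Nat.Coprime 3 q := (Nat.coprime_primes Nat.prime_three hq).mpr hq3.symm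
  obtain ⟨a, b, hab⟩ := Nat.isCoprime_iff_coprime.mpr hcop
  have hab' : (a : 𝓞 ℚ) * ((3 : ℕ) : 𝓞 ℚ) + (b : 𝓞 ℚ) * (q : 𝓞 ℚ) = 1 := by
    have h := congrArg (Int.cast : ℤ → 𝓞 ℚ) hab
    simpa using h
  apply v.isPrime.ne_top
  rw [Ideal.eq_top_iff_one, ← hab']
  exact v.asIdeal.add_mem (v.asIdeal.mul_mem_left _ h3) (v.asIdeal.mul_mem_left _ hv)

/-- **Piece B from its helpers, the tree's Chebotarev fact and Fisher's named fact (PROVED GLUE).** -/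
theorem cuspMemberSource_of_helpers (hF : thm132_geomTorsionFive_of_hesseFamily) :
    CuspMemberSource := by
  intro c₄ c₆ hΔ _ M _ τ hMdvd hτ hχ5
  have hM0 : M ≠ 0 := NeZero.ne M
  have h30M : 30 * (c₄ ^ 3 - c₆ ^ 2).natAbs ∣ M :=
    dvd_trans (mul_dvd_mul_right (by norm_num) _) hMdvd
  have h330M : 330 * (c₄ ^ 3 - c₆ ^ 2).natAbs ∣ M :=
    dvd_trans (mul_dvd_mul_right (by norm_num) _) hMdvd
  have h5M : 5 ∣ M := dvd_trans (dvd_mul_of_dvd_left (by norm_num) _) hMdvd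
  have h3M : 3 ∣ M := dvd_trans (dvd_mul_of_dvd_left (by norm_num) _) hMdvd
  have h8M : 8 ∣ M := dvd_trans (dvd_mul_of_dvd_left (by norm_num) _) hMdvd
  have h2M : 2 ≤ M := by obtain ⟨k, hk⟩ := h8M; omega
  -- B1: Chebotarev for `base[M]`, `σ = τ²`, avoiding the primes dividing `M`
  obtain ⟨q, v, 𝔓, φ, hq, hqS, hv, h𝔓, hφ, hφτ⟩ :=
    chebotarev_geomTorsion_holds (base (c₄ : ℚ) (c₆ : ℚ)) (M : ℤ) (by exact_mod_cast hM0)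
      (↑(Nat.divisors M)) (Finset.finite_toSet _) (τ * τ)
  have hqM : ¬ q ∣ M := fun h => hqS (Finset.mem_coe.mpr (Nat.mem_divisors.mpr ⟨h, hM0⟩))
  have hq30 : ¬ (q : ℤ) ∣ 30 * (c₄ ^ 3 - c₆ ^ 2) := by
    intro h
    have h1 := Int.natCast_dvd.mp h
    rw [Int.natAbs_mul, show (30 : ℤ).natAbs = 30 from rfl] at h1
    exact hqM (dvd_trans h1 h30M)
  have hq330 : ¬ (q : ℤ) ∣ 330 * (c₄ ^ 3 - c₆ ^ 2) := by
    intro h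
    have h1 := Int.natCast_dvd.mp h
    rw [Int.natAbs_mul, show (330 : ℤ).natAbs = 330 from rfl] at h1
    exact hqM (dvd_trans h1 h330M)
  -- B2/B3/B4: `φ = −1` on `base[5]`, `χ̄₅(φ) = χ̄₃(φ) = 1`, `χ̄_M(φ) = χ̄_M(τ²)`
  have h5' : ∀ P : (base (c₄ : ℚ) (c₆ : ℚ)).geomTorsion ((5 : ℕ) : ℤ), φ • P = (τ * τ) • P :=
    fun P => helper_smul_eq_of_dvd _ (by exact_mod_cast h5M) hφτ P
  have h3' : ∀ P : (base (c₄ : ℚ) (c₆ : ℚ)).geomTorsion ((3 : ℕ) : ℤ), φ • P = (τ * τ) • P :=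
    fun P => helper_smul_eq_of_dvd _ (by exact_mod_cast h3M) hφτ P
  have hnegB : ∀ P : (base (c₄ : ℚ) (c₆ : ℚ)).geomTorsion 5, φ • P = -P := fun P => by
    rw [h5' P, mul_smul, hτ P]
  have hχ5φ : modNCyclotomicCharacter ℚ 5 φ = 1 := by
    rw [helper_cyclotomic_eq_of_smul_eq (n := 5) (base (c₄ : ℚ) (c₆ : ℚ)) (by norm_num) h5', hχ5]
  have hχ3φ : modNCyclotomicCharacter ℚ 3 φ = 1 := by
    rw [helper_cyclotomic_eq_of_smul_eq (n := 3) (base (c₄ : ℚ) (c₆ : ℚ)) (by norm_num) h3',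
      helper_chi3_sq]
  have hχM : modNCyclotomicCharacter ℚ M φ = modNCyclotomicCharacter ℚ M (τ * τ) :=
    helper_cyclotomic_eq_of_smul_eq (base (c₄ : ℚ) (c₆ : ℚ)) h2M hφτ
  -- B6/B7: the cusp-adjacent parameter `l`
  obtain ⟨r, hr⟩ := helper_D_root_mod_q c₄ c₆ hΔ hq hq30 hv h𝔓 hφ hχ5φ hnegB
  obtain ⟨l, hl⟩ := helper_lift_root hq c₄ c₆ r hq30 hr
  -- B8: elliptic, multiplicative at `q`, `v_q(Δ_min) = 5`
  obtain ⟨hEll, hmult, hord⟩ := helper_member_multiplicative c₄ c₆ l hΔ hq hq330 hl hv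
  haveI := hEll
  -- F1: the `5`-congruence (Fisher Thm 13.2, named fact)
  have hcongr : Congr (member (c₄ : ℚ) (c₆ : ℚ) (l : ℚ) 1) (base (c₄ : ℚ) (c₆ : ℚ)) :=
    congr_member_base hF (c₄ : ℚ) (c₆ : ℚ) (l : ℚ)
  refine ⟨l, hEll, q, v, 𝔓, φ, hq, hqM, hv, h𝔓, hφ, hcongr, ?_, hmult, hord, ?_, hχ3φ, hχ5φ, hχM⟩
  · -- B9: semistable away from `M`
    intro w hw
    refine helper_isSemistableAt_member c₄ c₆ l hΔ hcongr fun h => hw ?_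
    obtain ⟨k, hk⟩ := h30M
    rw [hk, Nat.cast_mul]
    exact Ideal.mul_mem_right _ _ h
  · -- `φ = −1` on `member[5]` through the equivariant `e`
    obtain ⟨e, he⟩ := hcongr
    intro P
    apply e.injective
    rw [he, hnegB, map_neg]

/-- **Piece C from its helpers and the tree's inertial transvection (PROVED GLUE).** -/
theorem surjThreeOfCuspData_of_helpers : SurjThreeOfCuspData := by
  intro E _ M _ q v 𝔓 φ τ h8 h3M hss hq hqM hv h𝔓 hφ hmult hord hneg h3 h5 hM
  have hq3 : q ≠ 3 := by rintro rfl; exact hqM h3M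
  have h3v : ((3 : ℕ) : 𝓞 ℚ) ∉ v.asIdeal := helper_three_not_mem hq hq3 hv
  have hdvd : 3 ∣ Nat.card (galoisRepTorsion E ((3 : ℕ) : ℤ)).range :=
    E.dvd_card_range_galoisRepTorsion_of_hasMultiplicativeReductionAt_of_not_dvd hmult
      Nat.prime_three h3v (by rw [hord]; decide)
  refine helper_surjective_three_of_irreducible_of_three_dvd E ?_ hdvd
  by_contra hirr
  obtain ⟨P, hP0, hst⟩ := helper_stable_line_of_not_irreducible E hirr
  obtain ⟨r, hker, hr⟩ := helper_lineChar E hP0 hst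
  have hφP : φ • P = -P :=
    helper_neg_on_line_of_add_one_sq E (helper_frob_addOneSq_three E hmult h𝔓 hφ h3 h5 hneg)
      hP0 (hst φ)
  have hr1 : r φ = -1 := helper_character_neg_one E hP0 hr hφP
  have hunr : ∀ (w : HeightOneSpectrum (𝓞 ℚ)), (M : 𝓞 ℚ) ∉ w.asIdeal →
      ∀ 𝔓' ∈ w.primesAbove, ∀ σ ∈ 𝔓'.inertia (absoluteGaloisGroup ℚ), r σ = 1 := by
    intro w hw 𝔓' h𝔓' σ hσ
    have h3w : ((3 : ℕ) : 𝓞 ℚ) ∉ w.asIdeal := fun h => hw (by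
      obtain ⟨k, hk⟩ := h3M
      rw [hk, Nat.cast_mul]
      exact Ideal.mul_mem_right _ _ h)
    exact helper_lineChar_unramified E hP0 hr h3w (hss w hw) h𝔓' hσ
  have heq : r φ = r (τ * τ) := helper_char_eq_of_cyclotomic_eq h8 r hker hunr hM
  rw [map_mul, units_zmod3_mul_self] at heq
  rw [heq] at hr1
  exact absurd hr1 (by decide)

/-- **EVERYTHING ⇒ the registered stub (PROVED modulo the `sorry`'d helpers and the two named facts
`chebotarev_geomTorsion` (PROVED in the tree) and `thm132_geomTorsionFive_of_hesseFamily` (OPEN)).** -/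
theorem stubSwitch_of_helpers (hF : thm132_geomTorsionFive_of_hesseFamily) : StubSwitch :=
  stubSwitch_of_pieces (squareSource_of negOneIsSquare) integralModel
    (cuspMemberSource_of_helpers hF) surjThreeOfCuspData_of_helpers

/-! ## sanity: tree inputs consumed by the compositions exist with the expected shape -/

example : chebotarev_geomTorsion := chebotarev_geomTorsion_holds

example (E : WeierstrassCurve ℚ) [E.IsElliptic] {v : HeightOneSpectrum (𝓞 ℚ)}
    (hmult : E.HasMultiplicativeReductionAt v) (h3v : ((3 : ℕ) : 𝓞 ℚ) ∉ v.asIdeal)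
    (h5 : E.ordMinimalDiscriminant v = 5) :
    3 ∣ Nat.card (galoisRepTorsion E ((3 : ℕ) : ℤ)).range :=
  E.dvd_card_range_galoisRepTorsion_of_hasMultiplicativeReductionAt_of_not_dvd hmult Nat.prime_three
    h3v (by rw [h5]; decide)

example {K : Type} [Field K] [NumberField K] (W : WeierstrassCurve K) [W.IsElliptic]
    (v : HeightOneSpectrum (𝓞 K)) (h : W.HasMultiplicativeReductionAt v) :=
  TateCurve.exists_twistedTateUniformisation_tateJ W v h

example {K : Type} [Field K] [NumberField K] (W : WeierstrassCurve K) [W.IsElliptic]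
    (v : HeightOneSpectrum (𝓞 K)) {m : ℕ} (hm3 : 3 ≤ m) (hmv : (m : 𝓞 K) ∉ v.asIdeal)
    (h : ∀ σ ∈ GreenbergSelmer.inertia v, ∀ Q : W.geomTorsion (m : ℤ), σ • Q = Q) :
    W.IsSemistableAt v := by
  rw [isSemistableAt_iff_not_hasAdditiveReductionAt]
  intro hadd
  obtain ⟨σ, hσ, Q, hQ⟩ := W.exists_mem_inertia_smul_geomTorsion_ne_of_hasAdditiveReductionAt hadd hm3 hmv
  exact hQ (h σ hσ Q)

example {K : Type} [Field K] [NumberField K] (W : WeierstrassCurve K) [W.IsElliptic]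
    {v : HeightOneSpectrum (𝓞 K)} (hv : W.HasGoodReductionAt v) {n : ℤ} (hn : (n : 𝓞 K) ∉ v.asIdeal)
    {τ : absoluteGaloisGroup K} (hτ : τ ∈ (adicCompletionPrime K v).inertia (absoluteGaloisGroup K))
    (P : W.geomTorsion n) : τ • P = P :=
  W.smul_geomTorsion_eq_of_mem_inertia hv hn (adicCompletionPrime_mem_primesAbove K v) hτ P

end Summit.ABC.ABC.Cruxes.FreyModularity.StubSwitchK2G8

end
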